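import Summits.RiemannHypothesis.RiemannHypothesis.Theorems.PfPersistenceThetaIntegral
import Summits.RiemannHypothesis.RiemannHypothesis.Theorems.PfPersistenceCentralMassFloor
import HarnessLib

/-!
# The Galerkin down-cone lemma and the guarded one-prime form bound (pub-rhpf fake-4, landed by barrier-prover
gen 2 after the dedup bounce of p186530; mechanism/rigidity campaign; no RH claims)

From the integral representation of `thetaEven` (`PfPersistenceThetaIntegral`):
* `sum_thetaEven_eq_autocorr`: `Σ_n Σ_m v_n θ_{nm}(y) v_m = ∫_{-L/2}^{L/2-y} θ_v(x) θ_v(x+y) dx` — every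
  `θ`-kernel form is a WINDOWED AUTOCORRELATION of the profile `θ_v = Σ v_n ξ_n`; in particular the one-prime
  pattern form is `autocorr(log p)` and the prime-block form is `2 Σ_q w(q) autocorr(log q)`.
* `galerkin_downCone` (**the Galerkin DOWN-CONE lemma**): if `w' ≤ w` on the prime powers a genuine window
  reaches, then `Q_w(v) ≤ Q_{w'}(v)` on every ONE-SIGNED profile `v` (autocorrelations of one-signed profiles
  are `≥ 0`); so a down-cone table (random-multiplicative dressing `f·w_ζ` with `f ≤ 1`, deletion, dial
  `K ≤ 1`) can fail window positivity only through NODAL profiles (`not_oneSigned_of_downCone_negative`).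
* `primePattern_form_abs_le` (**guarded form bound**): at a genuine window REACHING `p`,
  `|v ⬝ᵥ (primePattern p win · v)| ≤ v ⬝ᵥ v` (`2|fg| ≤ f² + g²` plus `autocorr(0) = v ⬝ᵥ v`); the unguarded
  `PrimePatternFormBounded p` is false (windows not reaching `p`). `dial_form_abs_le` is the dial lemma's
  estimate with its hypothesis discharged at genuine windows.
-/

set_option linter.dupNamespace false

noncomputable section

namespace Summit.RiemannHypothesis.RiemannHypothesis.Theorems.PfPersistence

open Real intervalIntegral MeasureTheory Set Matrix

/-! ## 5. Quadratic forms in the `θ`-kernel are windowed autocorrelations of the profile -/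

-- Continuity of the modes `xiEven` and of profiles is `CentralMassFloor.continuous_xiEven` /
-- `CentralMassFloor.continuous_profile` (tree, `@[fun_prop]`), imported above and reused here.

/-- `v ⬝ᵥ (M v) = Σ_n Σ_m v_n M_{nm} v_m`. [folklore] -/
theorem dotProduct_mulVec_eq_sum {N : ℕ} (M : Matrix (Fin (N + 1)) (Fin (N + 1)) ℝ) (v : Fin (N + 1) → ℝ) :
    v ⬝ᵥ (M *ᵥ v) = ∑ n, ∑ m, v n * M n m * v m := by
  simp only [dotProduct, Matrix.mulVec, Finset.mul_sum, mul_assoc]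

/-- The WINDOWED AUTOCORRELATION of the profile `θ_v` at lag `y`: `∫_{-L/2}^{L/2-y} θ_v(x) θ_v(x+y) dx`
(for `0 ≤ y ≤ L`: the integral over the part of the window whose `y`-translate stays in the window). [folklore] -/
def autocorr (L : ℝ) {N : ℕ} (v : Fin (N + 1) → ℝ) (y : ℝ) : ℝ :=
  ∫ x in (-(L / 2))..(L / 2 - y), profile L v x * profile L v (x + y)

/-- **PROVED**: the `θ`-kernel quadratic form is the windowed autocorrelation:
`Σ_n Σ_m v_n θ_{nm}(y) v_m = ∫_{-L/2}^{L/2-y} θ_v(x) θ_v(x+y) dx`. [folklore] -/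
theorem sum_thetaEven_eq_autocorr {L : ℝ} (hL : 0 < L) {N : ℕ} (v : Fin (N + 1) → ℝ) (y : ℝ) :
    ∑ n : Fin (N + 1), ∑ m : Fin (N + 1), v n * thetaEven L n m y * v m = autocorr L v y := by
  unfold autocorr
  have hint : ∀ x, profile L v x * profile L v (x + y)
      = ∑ n : Fin (N + 1), ∑ m : Fin (N + 1), v n * v m * (xiEven L n x * xiEven L m (x + y)) := by
    intro x; unfold profile; rw [Finset.sum_mul_sum]
    exact Finset.sum_congr rfl fun n _ => Finset.sum_congr rfl fun m _ => by ring
  simp_rw [hint]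
  rw [intervalIntegral.integral_finsetSum
    (f := fun (n : Fin (N + 1)) x => ∑ m : Fin (N + 1), v n * v m * (xiEven L n x * xiEven L m (x + y)))
    (fun n _ => Continuous.intervalIntegrable (by fun_prop) _ _)]
  refine Finset.sum_congr rfl fun n _ => ?_
  rw [intervalIntegral.integral_finsetSum
    (f := fun (m : Fin (N + 1)) x => v n * v m * (xiEven L n x * xiEven L m (x + y)))
    (fun m _ => Continuous.intervalIntegrable (by fun_prop) _ _)]
  refine Finset.sum_congr rfl fun m _ => ?_
  rw [intervalIntegral.integral_const_mul, ← thetaEven_eq_integral hL]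
  ring

/-- **PROVED**: the ONE-PRIME PATTERN FORM is the autocorrelation at lag `log p`:
`v ⬝ᵥ (primePattern p win · v) = ∫ θ_v(x) θ_v(x + log p) dx`. [folklore] -/
theorem primePattern_form_eq_autocorr {win : Window} (ha : 0 < win.a) (p : ℕ) (v : Fin (win.N + 1) → ℝ) :
    v ⬝ᵥ (primePattern p win *ᵥ v) = autocorr (2 * win.a) v (Real.log p) := by
  rw [dotProduct_mulVec_eq_sum, ← sum_thetaEven_eq_autocorr (by positivity)]
  rfl

/-! ## 6. One-signed profiles have nonnegative autocorrelation at every lag inside the window -/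

/-- **PROVED**: `0 ≤ y ≤ L` and `θ_v` one-signed on `[-L/2, L/2]` ⇒ `0 ≤ ∫_{-L/2}^{L/2-y} θ_v(x) θ_v(x+y) dx`. [folklore] -/
theorem autocorr_nonneg_of_oneSigned {L : ℝ} {N : ℕ} {v : Fin (N + 1) → ℝ} (hv : OneSigned L v)
    {y : ℝ} (hy0 : 0 ≤ y) (hyL : y ≤ L) : 0 ≤ autocorr L v y := by
  unfold autocorr
  apply intervalIntegral.integral_nonneg (by linarith)
  intro x hx
  have hx1 : x ∈ Set.Icc (-(L / 2)) (L / 2) := ⟨hx.1, by linarith [hx.2]⟩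
  have hx2 : x + y ∈ Set.Icc (-(L / 2)) (L / 2) := ⟨by linarith [hx.1], by linarith [hx.2]⟩
  rcases hv with h | h
  · exact mul_nonneg (h x hx1) (h _ hx2)
  · nlinarith [h x hx1, h _ hx2]

/-- Prime powers reaching a support of length `L ≥ 0` have `log q ≤ L`. [folklore] -/
theorem log_le_of_mem_primeRange {L : ℝ} (hL : 0 ≤ L) {q : ℕ} (hq : q ∈ primeRange L) :
    Real.log q ≤ L := by
  unfold primeRange at hq
  rw [Finset.mem_range] at hq
  have hq' : q ≤ ⌊Real.exp L⌋₊ := Nat.lt_succ_iff.mp hq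
  rcases Nat.eq_zero_or_pos q with rfl | hpos
  · simpa using hL
  · have hqR : (q : ℝ) ≤ Real.exp L := (Nat.le_floor_iff (Real.exp_pos L).le).mp hq'
    calc Real.log q ≤ Real.log (Real.exp L) := Real.log_le_log (by exact_mod_cast hpos) hqR
      _ = L := Real.log_exp L

/-- **PROVED**: at a window reaching `p`, the one-prime pattern form is NONNEGATIVE on one-signed profiles. [folklore] -/
theorem primePattern_form_nonneg_of_oneSigned {win : Window} (ha : 0 < win.a) {p : ℕ}
    (hp : p ∈ primeRange (2 * win.a)) {v : Fin (win.N + 1) → ℝ} (hv : OneSigned (2 * win.a) v) :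
    0 ≤ v ⬝ᵥ (primePattern p win *ᵥ v) := by
  rw [primePattern_form_eq_autocorr ha]
  exact autocorr_nonneg_of_oneSigned hv (Real.log_natCast_nonneg p) (log_le_of_mem_primeRange (by positivity) hp)

/-! ## 7. The Galerkin DOWN-CONE lemma -/

/-- **PROVED**: the prime-block form is a positive combination of autocorrelations:
`v ⬝ᵥ (primesBlock w win · v) = 2 Σ_{q ∈ primeRange 2a} w(q) · autocorr_{2a}(v)(log q)`. [folklore] -/
theorem primesBlock_form_eq {win : Window} (ha : 0 < win.a) (w : Weights) (v : Fin (win.N + 1) → ℝ) :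
    v ⬝ᵥ (primesBlock w win *ᵥ v)
      = 2 * ∑ q ∈ primeRange (2 * win.a), w q * autocorr (2 * win.a) v (Real.log q) := by
  have hL : 0 < 2 * win.a := by positivity
  rw [dotProduct_mulVec_eq_sum]
  simp only [primesBlock, WP]
  simp_rw [← sum_thetaEven_eq_autocorr hL]
  calc ∑ n : Fin (win.N + 1), ∑ m : Fin (win.N + 1),
        v n * (2 * ∑ q ∈ primeRange (2 * win.a), w q * thetaEven (2 * win.a) n m (Real.log q)) * v m
      = ∑ n : Fin (win.N + 1), ∑ m : Fin (win.N + 1), ∑ q ∈ primeRange (2 * win.a),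
          2 * (w q * (v n * thetaEven (2 * win.a) n m (Real.log q) * v m)) := by
        refine Finset.sum_congr rfl fun n _ => Finset.sum_congr rfl fun m _ => ?_
        rw [Finset.mul_sum, Finset.mul_sum, Finset.sum_mul]
        exact Finset.sum_congr rfl fun q _ => by ring
    _ = ∑ q ∈ primeRange (2 * win.a), ∑ n : Fin (win.N + 1), ∑ m : Fin (win.N + 1),
          2 * (w q * (v n * thetaEven (2 * win.a) n m (Real.log q) * v m)) := by
        rw [Finset.sum_congr rfl fun n _ => Finset.sum_comm, Finset.sum_comm]
    _ = 2 * ∑ q ∈ primeRange (2 * win.a), w q * ∑ n : Fin (win.N + 1), ∑ m : Fin (win.N + 1),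
          v n * thetaEven (2 * win.a) n m (Real.log q) * v m := by
        rw [Finset.mul_sum]
        refine Finset.sum_congr rfl fun q _ => ?_
        rw [Finset.mul_sum, Finset.mul_sum]
        refine Finset.sum_congr rfl fun n _ => ?_
        rw [Finset.mul_sum, Finset.mul_sum]

/-- **PROVED**: only the prime block sees the weights:
`Q_{w'}(v) − Q_w(v) = P_w(v) − P_{w'}(v)` (polar and archimedean blocks cancel). [folklore] -/
theorem evenBlock_form_sub {win : Window} (w w' : Weights) (v : Fin (win.N + 1) → ℝ) :
    v ⬝ᵥ (evenBlock w' win *ᵥ v) - v ⬝ᵥ (evenBlock w win *ᵥ v)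
      = v ⬝ᵥ (primesBlock w win *ᵥ v) - v ⬝ᵥ (primesBlock w' win *ᵥ v) := by
  rw [evenBlock_eq_decomp, evenBlock_eq_decomp]
  simp only [Matrix.sub_mulVec, dotProduct_sub]
  ring

/-- **THE GALERKIN DOWN-CONE LEMMA (PROVED).** If the weight table `w'` lies BELOW `w` at every prime power
the window reaches (`w' q ≤ w q`), then on every ONE-SIGNED profile the even-block form of `w'` DOMINATES that of
`w`: `Q_w(v) ≤ Q_{w'}(v)`. (Random-multiplicative-function dressings `w' = f · w_ζ` with `f ≤ 1`, deletions and
dials `K ≤ 1` of `ζ` are all down-cone.) Mechanism: `Q_{w'} − Q_w = 2 Σ_q (w q − w' q) · autocorr(log q) ≥ 0`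
termwise. No RH input. [folklore] -/
theorem galerkin_downCone {win : Window} (ha : 0 < win.a) {w w' : Weights}
    (hle : ∀ q ∈ primeRange (2 * win.a), w' q ≤ w q) {v : Fin (win.N + 1) → ℝ} (hv : OneSigned (2 * win.a) v) :
    v ⬝ᵥ (evenBlock w win *ᵥ v) ≤ v ⬝ᵥ (evenBlock w' win *ᵥ v) := by
  rw [← sub_nonneg, evenBlock_form_sub, primesBlock_form_eq ha, primesBlock_form_eq ha, ← mul_sub,
    ← Finset.sum_sub_distrib]
  refine mul_nonneg (by norm_num) (Finset.sum_nonneg fun q hq => ?_)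
  rw [← sub_mul]
  exact mul_nonneg (sub_nonneg.2 (hle q hq))
    (autocorr_nonneg_of_oneSigned hv (Real.log_natCast_nonneg q) (log_le_of_mem_primeRange (by positivity) hq))

/-- **NODAL FORCING (PROVED).** At a window where `w`'s block is nonnegative on one-signed profiles, every
NEGATIVE direction of a down-cone table `w' ≤ w` is NODAL (its profile changes sign on the window): a down-cone
fake can fail window positivity only through sign-changing profiles — it can never close a one-signedness
(`S3-I1`-type) leaf. [folklore] -/
theorem not_oneSigned_of_downCone_negative {win : Window} (ha : 0 < win.a) {w w' : Weights}
    (hle : ∀ q ∈ primeRange (2 * win.a), w' q ≤ w q)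
    (hpos : ∀ u : Fin (win.N + 1) → ℝ, OneSigned (2 * win.a) u → 0 ≤ u ⬝ᵥ (evenBlock w win *ᵥ u))
    {v : Fin (win.N + 1) → ℝ} (hneg : v ⬝ᵥ (evenBlock w' win *ᵥ v) < 0) : ¬ OneSigned (2 * win.a) v :=
  fun hv => (lt_irrefl (0 : ℝ)) (((hpos v hv).trans (galerkin_downCone ha hle hv)).trans_lt hneg)

/-- `ζ`'s weights are nonnegative. [folklore] -/
theorem zetaWeights_nonneg (q : ℕ) : 0 ≤ zetaWeights q := by
  unfold zetaWeights
  exact mul_nonneg (by exact_mod_cast ArithmeticFunction.vonMangoldt_nonneg) (by positivity)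

/-- **PROVED**: a multiplicative DRESSING `q ↦ f(q) · w_ζ(q)` with `f ≤ 1` (Rademacher signs, real parts of
Steinhaus phases, deletions `f ∈ {0,1}`, dials `f(p^k) = K ≤ 1`) is down-cone, hence dominates `ζ` on one-signed
profiles at every genuine window. [folklore] -/
theorem galerkin_downCone_dressing {win : Window} (ha : 0 < win.a) {f : ℕ → ℝ} (hf : ∀ q, f q ≤ 1)
    {v : Fin (win.N + 1) → ℝ} (hv : OneSigned (2 * win.a) v) :
    v ⬝ᵥ (evenBlock zetaWeights win *ᵥ v) ≤ v ⬝ᵥ (evenBlock (fun q => f q * zetaWeights q) win *ᵥ v) :=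
  galerkin_downCone ha (fun q _ => by
    have := mul_le_mul_of_nonneg_right (hf q) (zetaWeights_nonneg q)
    simpa using this) hv

/-- **PROVED**: the `p`-dial with `K ≤ 1` of a nonnegative table is down-cone. [folklore] -/
theorem galerkin_downCone_dial {win : Window} (ha : 0 < win.a) {w : Weights} (hw : ∀ q, 0 ≤ w q) (p : ℕ)
    {K : ℝ} (hK : K ≤ 1) {v : Fin (win.N + 1) → ℝ} (hv : OneSigned (2 * win.a) v) :
    v ⬝ᵥ (evenBlock w win *ᵥ v) ≤ v ⬝ᵥ (evenBlock (dial p K w) win *ᵥ v) :=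
  galerkin_downCone ha (fun q _ => by
    unfold dial
    split_ifs with h
    · have := mul_le_mul_of_nonneg_right hK (hw q); simpa using this
    · exact le_rfl) hv


/-! ## 8. The guarded form bound (repair of the refuted unguarded `PrimePatternFormBounded`) -/

/-- `θ_{nm}(0) = δ_{nm}` (for `L ≠ 0`). [folklore] -/
theorem thetaEven_zero_apply {L : ℝ} (hL : L ≠ 0) (n m : ℕ) :
    thetaEven L n m 0 = if n = m then 1 else 0 := by
  unfold thetaEven
  by_cases hn : n = 0 <;> by_cases hm : m = 0
  · subst hn; subst hm; simp [div_self hL]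
  · subst hn; simp [hm, Ne.symm hm]
  · subst hm; simp [hn]
  · by_cases hnm : n = m
    · subst hnm; simp [hn, div_self hL]
    · simp [hn, hm, hnm]

/-- **PROVED**: `autocorr_L(v)(0) = ∫_{-L/2}^{L/2} θ_v² = v ⬝ᵥ v` (orthonormality of the modes, read off
`θ_{nm}(0) = δ_{nm}`). [folklore] -/
theorem autocorr_zero {L : ℝ} (hL : 0 < L) {N : ℕ} (v : Fin (N + 1) → ℝ) : autocorr L v 0 = v ⬝ᵥ v := by
  rw [← sum_thetaEven_eq_autocorr hL]
  simp only [thetaEven_zero_apply hL.ne']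
  simp only [dotProduct, Fin.val_inj, mul_ite, mul_one, mul_zero, ite_mul, zero_mul, Finset.sum_ite_eq,
    Finset.mem_univ, if_true]

/-- `autocorr_L(v)(0) = ∫_{-L/2}^{L/2} θ_v²`. [folklore] -/
theorem autocorr_zero_eq_integral_sq (L : ℝ) {N : ℕ} (v : Fin (N + 1) → ℝ) :
    autocorr L v 0 = ∫ x in (-(L / 2))..(L / 2), profile L v x ^ 2 := by
  unfold autocorr
  simp only [sub_zero, add_zero, sq]

/-- **PROVED (Cauchy–Schwarz in the form `2|fg| ≤ f² + g²`)**: for lags inside the window,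
`|autocorr_L(v)(y)| ≤ v ⬝ᵥ v`. [folklore] -/
theorem abs_autocorr_le {L : ℝ} (hL : 0 < L) {N : ℕ} (v : Fin (N + 1) → ℝ) {y : ℝ} (hy0 : 0 ≤ y)
    (hyL : y ≤ L) : |autocorr L v y| ≤ v ⬝ᵥ v := by
  set θ : ℝ → ℝ := fun x => profile L v x with hθ
  have hθc : Continuous θ := CentralMassFloor.continuous_profile L v
  have hab : -(L / 2) ≤ L / 2 - y := by linarith
  have hsq : v ⬝ᵥ v = ∫ x in (-(L / 2))..(L / 2), θ x ^ 2 := by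
    rw [← autocorr_zero hL, autocorr_zero_eq_integral_sq]
  have h1 : |autocorr L v y| ≤ ∫ x in (-(L / 2))..(L / 2 - y), |θ x * θ (x + y)| :=
    intervalIntegral.abs_integral_le_integral_abs hab
  have h2 : ∫ x in (-(L / 2))..(L / 2 - y), |θ x * θ (x + y)|
      ≤ ∫ x in (-(L / 2))..(L / 2 - y), ((1 / 2) * θ x ^ 2 + (1 / 2) * θ (x + y) ^ 2) := by
    refine intervalIntegral.integral_mono_on hab (Continuous.intervalIntegrable (by fun_prop) _ _)
      (Continuous.intervalIntegrable (by fun_prop) _ _) fun x _ => ?_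
    exact abs_le.2 ⟨by nlinarith [sq_nonneg (θ x + θ (x + y))], by nlinarith [sq_nonneg (θ x - θ (x + y))]⟩
  have h3 : ∫ x in (-(L / 2))..(L / 2 - y), ((1 / 2) * θ x ^ 2 + (1 / 2) * θ (x + y) ^ 2)
      = (1 / 2) * (∫ x in (-(L / 2))..(L / 2 - y), θ x ^ 2)
        + (1 / 2) * (∫ x in (-(L / 2) + y)..(L / 2), θ x ^ 2) := by
    rw [intervalIntegral.integral_add (Continuous.intervalIntegrable (by fun_prop) _ _)
      (Continuous.intervalIntegrable (by fun_prop) _ _), intervalIntegral.integral_const_mul,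
      intervalIntegral.integral_const_mul,
      intervalIntegral.integral_comp_add_right (fun x => θ x ^ 2) y, sub_add_cancel]
  have hnn : 0 ≤ᵐ[volume.restrict (Set.Ioc (-(L / 2)) (L / 2))] fun x => θ x ^ 2 :=
    Filter.Eventually.of_forall fun x => by simp only [Pi.zero_apply]; positivity
  have hfi : IntervalIntegrable (fun x => θ x ^ 2) volume (-(L / 2)) (L / 2) :=
    Continuous.intervalIntegrable (by fun_prop) _ _
  have h4 : ∫ x in (-(L / 2))..(L / 2 - y), θ x ^ 2 ≤ ∫ x in (-(L / 2))..(L / 2), θ x ^ 2 :=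
    intervalIntegral.integral_mono_interval le_rfl hab (by linarith) hnn hfi
  have h5 : ∫ x in (-(L / 2) + y)..(L / 2), θ x ^ 2 ≤ ∫ x in (-(L / 2))..(L / 2), θ x ^ 2 :=
    intervalIntegral.integral_mono_interval (by linarith) (by linarith) le_rfl hnn hfi
  calc |autocorr L v y| ≤ _ := h1
    _ ≤ _ := h2
    _ = _ := h3
    _ ≤ (1 / 2) * (∫ x in (-(L / 2))..(L / 2), θ x ^ 2) + (1 / 2) * (∫ x in (-(L / 2))..(L / 2), θ x ^ 2) := by
        gcongr
    _ = v ⬝ᵥ v := by rw [hsq]; ring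

/-- **THE GUARDED FORM BOUND (PROVED)**: at every genuine window REACHING `p`, the one-prime pattern is
form-bounded by the identity: `|v ⬝ᵥ (primePattern p win · v)| ≤ v ⬝ᵥ v`. (The unguarded
`PrimePatternFormBounded p` is FALSE — `not_primePatternFormBounded`: at windows not reaching `p` the `(0,0)`
entry `θ_{00}(log p) = (2a − log p)/2a` is unbounded below.) [folklore] -/
theorem primePattern_form_abs_le {win : Window} (ha : 0 < win.a) {p : ℕ} (hp : p ∈ primeRange (2 * win.a))
    (v : Fin (win.N + 1) → ℝ) : |v ⬝ᵥ (primePattern p win *ᵥ v)| ≤ v ⬝ᵥ v := by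
  rw [primePattern_form_eq_autocorr ha]
  exact abs_autocorr_le (by positivity) v (Real.log_natCast_nonneg p)
    (log_le_of_mem_primeRange (by positivity) hp)

/-- **PROVED (the dial lemma's hypothesis, discharged at genuine windows)**: the `p`-dial by a factor `K` moves
the even-block form by at most `2|K−1||w(p)|·(v ⬝ᵥ v)` at every window with `0 < a` (at windows not reaching
`p` it does not move it at all, `evenBlock_dial_of_not_mem`). [folklore] -/
theorem dial_form_abs_le {win : Window} (ha : 0 < win.a) (p : ℕ) (K : ℝ) (w : Weights)
    (v : Fin (win.N + 1) → ℝ) :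
    |v ⬝ᵥ (evenBlock w win *ᵥ v) - v ⬝ᵥ (evenBlock (dial p K w) win *ᵥ v)|
      ≤ 2 * |K - 1| * |w p| * (v ⬝ᵥ v) := by
  by_cases hp : p ∈ primeRange (2 * win.a)
  · rw [evenBlock_dial_eq hp, Matrix.sub_mulVec, dotProduct_sub, sub_sub_cancel, Matrix.smul_mulVec,
      dotProduct_smul, smul_eq_mul, abs_mul, abs_mul, abs_mul, abs_two]
    have h := primePattern_form_abs_le ha hp v
    have hnn : 0 ≤ 2 * |K - 1| * |w p| := by positivity
    exact mul_le_mul_of_nonneg_left h hnn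
  · rw [evenBlock_dial_of_not_mem (not_mem_primeRange_iff.1 hp), sub_self, abs_zero]
    exact mul_nonneg (by positivity) (dotProduct_self_nonneg_real v)

/-! ## §9. Certification-facing corollaries

The hypothesis `hpos` of `not_oneSigned_of_downCone_negative` (the reference block is nonnegative on one-signed
vectors) is implied by positive SEMIDEFINITENESS of the reference even block at the served window — a statement a
ball-arithmetic certificate decides for `ζ` at any fixed `(a, N)`; and an eigenvalue FLOOR for the reference
block transfers to every down-cone block on one-signed vectors (the Galerkin form of the pair primitive
`one-signed ∧ ε₁ ≥ ε₁^ζ(a,N)`). -/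

/-- **PROVED (Galerkin nodal forcing from a PSD certificate)**: if the reference even block `evenBlock w win`
is positive semidefinite and `w' ≤ w` on the primes of the window, then every vector on which the `w'`-block is
negative changes sign on the window. [folklore] -/
theorem not_oneSigned_of_negative_of_posSemidef {win : Window} (ha : 0 < win.a) {w w' : Weights}
    (hle : ∀ q ∈ primeRange (2 * win.a), w' q ≤ w q) (hpsd : (evenBlock w win).PosSemidef)
    {v : Fin (win.N + 1) → ℝ} (hneg : v ⬝ᵥ (evenBlock w' win *ᵥ v) < 0) : ¬ OneSigned (2 * win.a) v :=
  not_oneSigned_of_downCone_negative ha hle (fun u _ => by simpa using hpsd.dotProduct_mulVec_nonneg u) hneg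

/-- **PROVED (Galerkin energy floor on the down-cone)**: an eigenvalue floor `ε · (u ⬝ᵥ u) ≤ uᵀ Q_w u` for the
reference block (e.g. `ε = ε₁^ζ(a,N)`) holds for every down-cone block `Q_{w'}`, `w' ≤ w` on the window's
primes, on ONE-SIGNED vectors: the pair primitive `(u₁ one-signed) ∧ (ε₁ ≥ ε)` is never violated by down-cone
data at that window. [folklore] -/
theorem galerkin_downCone_floor {win : Window} (ha : 0 < win.a) {w w' : Weights} {ε : ℝ}
    (hle : ∀ q ∈ primeRange (2 * win.a), w' q ≤ w q)
    (hfloor : ∀ u : Fin (win.N + 1) → ℝ, ε * (u ⬝ᵥ u) ≤ u ⬝ᵥ (evenBlock w win *ᵥ u))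
    {v : Fin (win.N + 1) → ℝ} (hv : OneSigned (2 * win.a) v) :
    ε * (v ⬝ᵥ v) ≤ v ⬝ᵥ (evenBlock w' win *ᵥ v) :=
  (hfloor v).trans (galerkin_downCone ha hle hv)

end Summit.RiemannHypothesis.RiemannHypothesis.Theorems.PfPersistence

end
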